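import Summits.Ventures.PackingBounds.Configurations.SubspaceTransfer
import Summits.Ventures.PackingBounds.Energy.UniversalOptimalityCrossPolytope
import Summits.Ventures.PackingBounds.Energy.UniversalOptimalitySimplex

/-!
# The regular cross-polytope, the regular simplex and the `±` simplex as configurations, in EVERY dimension

Framing: lottery ticket; floor = certified bounds/negative ranges. Venture `PackingBounds` (cell `pub-packcert`, seat
`pub-packcert-sdp`), ATTAINED side. The tree proves the *bounds* for the regular simplex and the regular cross-polytope in
every dimension (`SphericalCodes/SimplexBound`, `SphericalCodes/DegreeTwoBound`, `Energy/UniversalOptimalitySimplex`,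
`Energy/UniversalOptimalityCrossPolytope`, `Energy/Riesz{2,4,6}SimplexCrossPolytopeAllDimensions`) but so far carried the
attaining configurations only for particular `n` (coordinate lists checked by `decide`). This file supplies them for
every `n`:

* `crossPolytope n` = `{± e_i} ⊆ ℝⁿ`: `2n` unit vectors, pairwise inner products `0` or `-1`, and for every potential `a`
  the energy `Σ_{x ≠ y} a(⟪x, y⟫) = 2n (a(-1) + (2n - 2) a(0))` (`crossPolytope_energy`);
* the regular simplex: `n + 1` unit vectors of `ℝⁿ` with all pairwise inner products `= -1/n` and energy
  `(n + 1) n a(-1/n)` (`exists_simplex`; built as `(n+1) e_i - 𝟙` in the hyperplane `𝟙^⊥ ⊆ ℝⁿ⁺¹` and moved to `ℝⁿ` by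
  `Config.exists_transfer_orthogonal_singleton`);
* the `±` simplex: `2n + 2` unit vectors of `ℝⁿ` (`n ≥ 2`) with pairwise inner products `≤ 1/n` (values `-1, ±1/n`)
  (`exists_pm_simplex`), whence `A(n, arccos s) ≥ 2n + 2` for every table angle `s ≥ 1/n` (rows for the B2c cells
  `(13, 1/9)`, `(14..17, 1/11)` in `SphericalCodes/PlusMinusSimplexRows.lean`).

With the tree's universal-optimality theorems (`Energy.UniversalCrossPolytope.universally_optimal`,
`Energy.UniversalSimplex.universally_optimal`, Cohn–Kumar Thm. 1.2 in every dimension `n ≥ 3`) the energies above are the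
ground-state energies: two-sided `IsLeast` statements `crossPolytope_energy_isLeast`, `simplex_energy_isLeast` for every
completely monotonic potential and every `n ≥ 3`. Elementary; no optimality claim beyond the tree's theorems.

## References
* J. H. Conway, N. J. A. Sloane, *Sphere Packings, Lattices and Groups*, 3rd ed., Ch. 1 §2.3 and Ch. 4 §6.1 (`Aₙ*`).
  [`ConwaySloane1999`]
* H. Cohn, A. Kumar, J. Amer. Math. Soc. 20 (2007) 99–148, Table 1 (simplex, cross-polytope). [`CohnKumar2006`]
-/

noncomputable section

open Finset
open scoped RealInnerProductSpace

namespace Summit.Ventures.PackingBounds.Config.SimplexCrossPolytope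

/-! ## The regular cross-polytope `{± e_i}` of `ℝⁿ` -/

/-- The vertex `± e_i` attached to `(i, b)`: `e_i` for `b = true`, `-e_i` for `b = false`. -/
def cpVec (n : ℕ) (p : Fin n × Bool) : EuclideanSpace ℝ (Fin n) :=
  EuclideanSpace.single p.1 (if p.2 then (1 : ℝ) else -1)

/-- The regular cross-polytope of `ℝⁿ`: the `2n` vectors `± e_i`. -/
def crossPolytope (n : ℕ) : Finset (EuclideanSpace ℝ (Fin n)) :=
  (univ : Finset (Fin n × Bool)).image (cpVec n)

/-- The sign `±1` attached to `b`. -/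
def sgn (b : Bool) : ℝ := if b then 1 else -1

/-- `sgn b ^ 2 = 1`. -/
theorem sgn_mul_self (b : Bool) : sgn b * sgn b = 1 := by unfold sgn; split_ifs <;> norm_num

/-- Distinct signs multiply to `-1`. -/
theorem sgn_mul_of_ne {b c : Bool} (h : b ≠ c) : sgn b * sgn c = -1 := by
  unfold sgn; cases b <;> cases c <;> simp_all

/-- A product of two signs is `±1`. -/
theorem sgn_mul_sgn (b c : Bool) : sgn b * sgn c = 1 ∨ sgn b * sgn c = -1 := by
  unfold sgn; cases b <;> cases c <;> simp

/-- Inner products of cross-polytope vertices. -/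
theorem inner_cpVec (n : ℕ) (p q : Fin n × Bool) :
    inner ℝ (cpVec n p) (cpVec n q) = if p.1 = q.1 then sgn p.2 * sgn q.2 else 0 := by
  unfold cpVec
  rw [EuclideanSpace.inner_single_left, PiLp.single_apply]
  simp only [conj_trivial, sgn]
  split_ifs <;> simp

/-- Cross-polytope vertices are unit vectors. -/
theorem norm_cpVec (n : ℕ) (p : Fin n × Bool) : ‖cpVec n p‖ = 1 := by
  unfold cpVec
  rw [PiLp.norm_single]
  split_ifs <;> simp

/-- `(i, b) ↦ ± e_i` is injective. -/
theorem cpVec_injective (n : ℕ) : Function.Injective (cpVec n) := by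
  intro p q h
  have h1 : inner ℝ (cpVec n p) (cpVec n p) = inner ℝ (cpVec n p) (cpVec n q) := by rw [h]
  rw [inner_cpVec, inner_cpVec, if_pos rfl, sgn_mul_self] at h1
  by_cases hpq : p.1 = q.1
  · rw [if_pos hpq] at h1
    by_cases hb : p.2 = q.2
    · exact Prod.ext hpq hb
    · rw [sgn_mul_of_ne hb] at h1; norm_num at h1
  · rw [if_neg hpq] at h1; norm_num at h1

/-- The cross-polytope has `2n` vertices. -/
theorem card_crossPolytope (n : ℕ) : (crossPolytope n).card = 2 * n := by
  rw [crossPolytope, card_image_of_injective _ (cpVec_injective n), card_univ, Fintype.card_prod,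
    Fintype.card_fin, Fintype.card_bool, mul_comm]

/-- Every vertex of the cross-polytope is a unit vector. -/
theorem norm_crossPolytope (n : ℕ) : ∀ x ∈ crossPolytope n, ‖x‖ = 1 := by
  intro x hx
  obtain ⟨p, _, rfl⟩ := mem_image.mp hx
  exact norm_cpVec n p

/-- Distinct vertices of the cross-polytope have inner product `0` or `-1`. -/
theorem inner_crossPolytope (n : ℕ) : ∀ x ∈ crossPolytope n, ∀ y ∈ crossPolytope n, x ≠ y →
    inner ℝ x y = 0 ∨ inner ℝ x y = -1 := by
  intro x hx y hy hxy
  obtain ⟨p, _, rfl⟩ := mem_image.mp hx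
  obtain ⟨q, _, rfl⟩ := mem_image.mp hy
  rw [inner_cpVec]
  by_cases hpq : p.1 = q.1
  · rw [if_pos hpq]
    by_cases hb : p.2 = q.2
    · exact absurd (congrArg (cpVec n) (Prod.ext hpq hb)) hxy
    · exact Or.inr (sgn_mul_of_ne hb)
  · exact Or.inl (if_neg hpq)

/-- Distinct vertices of the cross-polytope have inner product `≤ 0`. -/
theorem inner_crossPolytope_le (n : ℕ) : ∀ x ∈ crossPolytope n, ∀ y ∈ crossPolytope n, x ≠ y →
    inner ℝ x y ≤ 0 := by
  intro x hx y hy hxy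
  rcases inner_crossPolytope n x hx y hy hxy with h | h <;> linarith

/-- **Energy of the cross-polytope**: for every potential `a`, `Σ_{x ≠ y} a(⟪x, y⟫) = 2n (a(-1) + (2n - 2) a(0))`
(each vertex sees its antipode once and the `2n - 2` other vertices orthogonally). -/
theorem crossPolytope_energy (n : ℕ) (a : ℝ → ℝ) :
    ∑ x ∈ crossPolytope n, ∑ y ∈ (crossPolytope n).erase x, a (inner ℝ x y) =
      (2 * n : ℝ) * (a (-1) + (2 * n - 2) * a 0) := by
  classical
  have hinj := cpVec_injective n
  -- the inner sum is the same for every vertex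
  have hrow : ∀ p : Fin n × Bool, ∑ y ∈ ((univ : Finset (Fin n × Bool)).image (cpVec n)).erase (cpVec n p),
      a (inner ℝ (cpVec n p) y) = a (-1) + (2 * n - 2) * a 0 := by
    rintro ⟨i0, b0⟩
    rw [← image_erase hinj, sum_image fun x _ y _ h => hinj h, sum_erase_eq_sub (mem_univ _),
      inner_cpVec n (i0, b0) (i0, b0), if_pos rfl, sgn_mul_self, Fintype.sum_prod_type]
    have hterm : ∀ i : Fin n, ∑ b : Bool, a (inner ℝ (cpVec n (i0, b0)) (cpVec n (i, b))) =
        2 * a 0 + if i0 = i then a 1 + a (-1) - 2 * a 0 else 0 := by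
      intro i
      simp only [Fintype.sum_bool, inner_cpVec]
      by_cases hi : i0 = i
      · subst hi
        simp only [ite_true]
        cases b0
        · rw [show sgn false * sgn true = -1 from sgn_mul_of_ne (by decide), sgn_mul_self]; ring
        · rw [sgn_mul_self, show sgn true * sgn false = -1 from sgn_mul_of_ne (by decide)]; ring
      · simp only [hi, ite_false]; ring
    rw [Finset.sum_congr rfl fun i _ => hterm i, sum_add_distrib, sum_const, card_univ, Fintype.card_fin,
      sum_ite_eq, if_pos (mem_univ _), nsmul_eq_mul]
    ring
  rw [crossPolytope, sum_image fun x _ y _ h => hinj h, Finset.sum_congr rfl fun p _ => hrow p, sum_const, card_univ,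
    Fintype.card_prod, Fintype.card_fin, Fintype.card_bool, nsmul_eq_mul]
  push_cast
  ring

/-- **The regular cross-polytope as a code / configuration (every `n`)**: `2n` unit vectors of `ℝⁿ` with pairwise inner
products `≤ 0` and energy `2n (a(-1) + (2n - 2) a(0))` for every potential `a`. [cite: CohnKumar2006, Table 1] -/
theorem exists_crossPolytope (n : ℕ) : ∃ C : Finset (EuclideanSpace ℝ (Fin n)), C.card = 2 * n ∧
    (∀ x ∈ C, ‖x‖ = 1) ∧ (∀ x ∈ C, ∀ y ∈ C, x ≠ y → inner ℝ x y ≤ 0) ∧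
    ∀ a : ℝ → ℝ, ∑ x ∈ C, ∑ y ∈ C.erase x, a (inner ℝ x y) = (2 * n : ℝ) * (a (-1) + (2 * n - 2) * a 0) :=
  ⟨crossPolytope n, card_crossPolytope n, norm_crossPolytope n, inner_crossPolytope_le n, crossPolytope_energy n⟩

/-! ## The regular simplex and the `±` simplex: built in the hyperplane `𝟙^⊥ ⊆ ℝⁿ⁺¹`, moved to `ℝⁿ` -/

/-- The all-ones vector `𝟙` of `ℝⁿ⁺¹`. -/
def ones (n : ℕ) : EuclideanSpace ℝ (Fin (n + 1)) := WithLp.toLp 2 fun _ => (1 : ℝ)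

/-- Coordinates of `𝟙`. -/
@[simp] theorem ones_apply (n : ℕ) (i : Fin (n + 1)) : ones n i = 1 := rfl

/-- `𝟙 ≠ 0`. -/
theorem ones_ne_zero (n : ℕ) : ones n ≠ 0 := by
  intro h
  have h0 := congrArg (fun v : EuclideanSpace ℝ (Fin (n + 1)) => v 0) h
  simp at h0

/-- `⟪e_i, 𝟙⟫ = 1`. -/
theorem inner_single_ones (n : ℕ) (i : Fin (n + 1)) :
    inner ℝ (EuclideanSpace.single i (1 : ℝ)) (ones n) = 1 := by
  rw [EuclideanSpace.inner_single_left]; simp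

/-- `⟪𝟙, e_i⟫ = 1`. -/
theorem inner_ones_single (n : ℕ) (i : Fin (n + 1)) :
    inner ℝ (ones n) (EuclideanSpace.single i (1 : ℝ)) = 1 := by
  rw [real_inner_comm, inner_single_ones]

/-- `⟪𝟙, 𝟙⟫ = n + 1`. -/
theorem inner_ones_ones (n : ℕ) : inner ℝ (ones n) (ones n) = (n : ℝ) + 1 := by
  rw [real_inner_self_eq_norm_sq, EuclideanSpace.real_norm_sq_eq]
  simp

/-- `⟪e_i, e_j⟫ = δ_ij`. -/
theorem inner_single_single (n : ℕ) (i j : Fin (n + 1)) :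
    inner ℝ (EuclideanSpace.single i (1 : ℝ)) (EuclideanSpace.single j (1 : ℝ)) = if i = j then 1 else 0 := by
  rw [EuclideanSpace.inner_single_left, PiLp.single_apply]; simp

/-- The unnormalised simplex vertex `(n + 1) e_i - 𝟙`. -/
def pVec (n : ℕ) (i : Fin (n + 1)) : EuclideanSpace ℝ (Fin (n + 1)) :=
  ((n : ℝ) + 1) • EuclideanSpace.single i (1 : ℝ) - ones n

/-- `⟪p_i, p_j⟫ = (n+1)² δ_ij - (n+1)`. -/
theorem inner_pVec (n : ℕ) (i j : Fin (n + 1)) :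
    inner ℝ (pVec n i) (pVec n j) = if i = j then (n : ℝ) * (n + 1) else -((n : ℝ) + 1) := by
  simp only [pVec, inner_sub_left, inner_sub_right, real_inner_smul_left, real_inner_smul_right,
    inner_single_single, inner_single_ones, inner_ones_single, inner_ones_ones]
  split_ifs <;> ring

/-- `p_i ⊥ 𝟙`. -/
theorem inner_ones_pVec (n : ℕ) (i : Fin (n + 1)) : inner ℝ (ones n) (pVec n i) = 0 := by
  simp only [pVec, inner_sub_right, real_inner_smul_right, inner_ones_single, inner_ones_ones]; ring

/-- `‖p_i‖² = n (n + 1)`. -/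
theorem norm_pVec_sq (n : ℕ) (i : Fin (n + 1)) : ‖pVec n i‖ ^ 2 = (n : ℝ) * (n + 1) := by
  rw [← real_inner_self_eq_norm_sq, inner_pVec, if_pos rfl]

/-- `p_i ≠ 0` for `n ≥ 1`. -/
theorem pVec_ne_zero {n : ℕ} (hn : 1 ≤ n) (i : Fin (n + 1)) : pVec n i ≠ 0 := by
  intro h
  have h2 := norm_pVec_sq n i
  rw [h, norm_zero] at h2
  have h1 : (1 : ℝ) ≤ n := by exact_mod_cast hn
  nlinarith

/-- The simplex vertex `((n + 1) e_i - 𝟙) / √(n (n + 1))`. -/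
def qVec (n : ℕ) (i : Fin (n + 1)) : EuclideanSpace ℝ (Fin (n + 1)) := (‖pVec n i‖)⁻¹ • pVec n i

/-- Simplex vertices are unit vectors. -/
theorem norm_qVec {n : ℕ} (hn : 1 ≤ n) (i : Fin (n + 1)) : ‖qVec n i‖ = 1 :=
  norm_smul_inv_norm (pVec_ne_zero hn i)

/-- `q_i ⊥ 𝟙`. -/
theorem inner_ones_qVec (n : ℕ) (i : Fin (n + 1)) : inner ℝ (ones n) (qVec n i) = 0 := by
  rw [qVec, real_inner_smul_right, inner_ones_pVec, mul_zero]

/-- Inner products of simplex vertices: `1` on the diagonal, `-1/n` off it. -/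
theorem inner_qVec {n : ℕ} (hn : 1 ≤ n) (i j : Fin (n + 1)) :
    inner ℝ (qVec n i) (qVec n j) = if i = j then 1 else -1 / (n : ℝ) := by
  have hnn : ‖pVec n j‖ = ‖pVec n i‖ := by
    have h := norm_pVec_sq n j
    rw [← norm_pVec_sq n i] at h
    exact (pow_left_inj₀ (norm_nonneg _) (norm_nonneg _) two_ne_zero).mp h
  rw [qVec, qVec, real_inner_smul_left, real_inner_smul_right, ← mul_assoc, hnn, ← mul_inv, ← sq, norm_pVec_sq,
    inner_pVec]
  have h1 : (1 : ℝ) ≤ n := by exact_mod_cast hn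
  have hpos : (0 : ℝ) < (n : ℝ) * (n + 1) := by positivity
  split_ifs
  · exact inv_mul_cancel₀ hpos.ne'
  · field_simp

/-- `i ↦ q_i` is injective. -/
theorem qVec_injective {n : ℕ} (hn : 1 ≤ n) : Function.Injective (qVec n) := by
  intro i j h
  by_contra hij
  have h1 := inner_qVec hn i j
  rw [h, inner_qVec hn j j, if_pos rfl, if_neg hij] at h1
  have h2 : (0 : ℝ) < n := by exact_mod_cast hn
  have h3 : (-1 : ℝ) / n < 0 := div_neg_of_neg_of_pos (by norm_num) h2
  linarith

/-- **The regular simplex as a configuration (every `n ≥ 1`)**: `n + 1` unit vectors of `ℝⁿ` with all pairwise inner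
products `-1/n`, hence energy `(n + 1) n a(-1/n)` for every potential `a`. [cite: CohnKumar2006, Table 1] -/
theorem exists_simplex (n : ℕ) (hn : 1 ≤ n) : ∃ C : Finset (EuclideanSpace ℝ (Fin n)), C.card = n + 1 ∧
    (∀ x ∈ C, ‖x‖ = 1) ∧ (∀ x ∈ C, ∀ y ∈ C, x ≠ y → inner ℝ x y = -1 / (n : ℝ)) ∧
    ∀ a : ℝ → ℝ, ∑ x ∈ C, ∑ y ∈ C.erase x, a (inner ℝ x y) = ((n : ℝ) + 1) * n * a (-1 / (n : ℝ)) := by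
  classical
  obtain ⟨C', hcard, hnorm, hinner, -⟩ := exists_transfer_orthogonal_singleton (ones n) (ones_ne_zero n)
    ((univ : Finset (Fin (n + 1))).image (qVec n))
    (fun x hx => by obtain ⟨i, _, rfl⟩ := mem_image.mp hx; exact inner_ones_qVec n i)
  have hc : C'.card = n + 1 := by
    rw [hcard, card_image_of_injective _ (qVec_injective hn), card_univ, Fintype.card_fin]
  have h1 : ∀ x ∈ C', ‖x‖ = 1 := by
    intro x hx
    obtain ⟨y, hy, h⟩ := hnorm x hx
    obtain ⟨i, _, rfl⟩ := mem_image.mp hy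
    rw [h, norm_qVec hn]
  have h2 : ∀ x ∈ C', ∀ y ∈ C', x ≠ y → inner ℝ x y = -1 / (n : ℝ) := by
    intro x hx y hy hxy
    obtain ⟨x0, hx0, y0, hy0, hne, he⟩ := hinner x hx y hy hxy
    obtain ⟨i, _, rfl⟩ := mem_image.mp hx0
    obtain ⟨j, _, rfl⟩ := mem_image.mp hy0
    rw [he, inner_qVec hn, if_neg (fun h => hne (by rw [h]))]
  refine ⟨C', hc, h1, h2, fun a => ?_⟩
  calc ∑ x ∈ C', ∑ y ∈ C'.erase x, a (inner ℝ x y) = ∑ x ∈ C', ∑ y ∈ C'.erase x, a (-1 / (n : ℝ)) := by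
        refine sum_congr rfl fun x hx => sum_congr rfl fun y hy => ?_
        rw [h2 x hx y (mem_of_mem_erase hy) (ne_of_mem_erase hy).symm]
    _ = ((n : ℝ) + 1) * n * a (-1 / (n : ℝ)) := by
        rw [sum_congr rfl fun x hx => by rw [sum_const, card_erase_of_mem hx, hc, Nat.add_sub_cancel], sum_const, hc,
          smul_smul, nsmul_eq_mul]
        push_cast
        ring

/-- The `±` simplex vertex `± q_i`. -/
def pmVec (n : ℕ) (p : Fin (n + 1) × Bool) : EuclideanSpace ℝ (Fin (n + 1)) := sgn p.2 • qVec n p.1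

/-- Inner products of `±` simplex vertices. -/
theorem inner_pmVec {n : ℕ} (hn : 1 ≤ n) (p q : Fin (n + 1) × Bool) :
    inner ℝ (pmVec n p) (pmVec n q) = sgn p.2 * sgn q.2 * if p.1 = q.1 then 1 else -1 / (n : ℝ) := by
  rw [pmVec, pmVec, real_inner_smul_left, real_inner_smul_right, inner_qVec hn, mul_assoc]

/-- `±` simplex vertices are unit vectors. -/
theorem norm_pmVec {n : ℕ} (hn : 1 ≤ n) (p : Fin (n + 1) × Bool) : ‖pmVec n p‖ = 1 := by
  rw [pmVec, norm_smul, norm_qVec hn, mul_one, Real.norm_eq_abs]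
  unfold sgn; split_ifs <;> simp

/-- `± q_i ⊥ 𝟙`. -/
theorem inner_ones_pmVec (n : ℕ) (p : Fin (n + 1) × Bool) : inner ℝ (ones n) (pmVec n p) = 0 := by
  rw [pmVec, real_inner_smul_right, inner_ones_qVec, mul_zero]

/-- `(i, b) ↦ ± q_i` is injective for `n ≥ 2`. -/
theorem pmVec_injective {n : ℕ} (hn : 2 ≤ n) : Function.Injective (pmVec n) := by
  have hn1 : 1 ≤ n := le_trans (by norm_num) hn
  have h2 : (2 : ℝ) ≤ n := by exact_mod_cast hn
  intro p q h
  have h1 : inner ℝ (pmVec n p) (pmVec n p) = inner ℝ (pmVec n p) (pmVec n q) := by rw [h]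
  rw [inner_pmVec hn1, inner_pmVec hn1, if_pos rfl, sgn_mul_self, one_mul] at h1
  by_cases hpq : p.1 = q.1
  · rw [if_pos hpq, mul_one] at h1
    by_cases hb : p.2 = q.2
    · exact Prod.ext hpq hb
    · rw [sgn_mul_of_ne hb] at h1; norm_num at h1
  · rw [if_neg hpq] at h1
    have hlt : (1 : ℝ) / n < 1 := by rw [div_lt_one (by linarith)]; linarith
    rcases sgn_mul_sgn p.2 q.2 with hs | hs <;> rw [hs] at h1
    · have : (0 : ℝ) < 1 / n := by positivity
      linarith [show (1 : ℝ) * (-1 / n) = -(1 / n) by ring]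
    · linarith [show (-1 : ℝ) * (-1 / n) = 1 / n by ring]

/-- Distinct `±` simplex vertices have inner product `≤ 1/n` (the values are `-1` and `±1/n`). -/
theorem inner_pmVec_le {n : ℕ} (hn : 1 ≤ n) {p q : Fin (n + 1) × Bool} (hpq : p ≠ q) :
    inner ℝ (pmVec n p) (pmVec n q) ≤ 1 / (n : ℝ) := by
  have h1 : (1 : ℝ) ≤ n := by exact_mod_cast hn
  have hinv : (0 : ℝ) < 1 / n := by positivity
  rw [inner_pmVec hn]
  by_cases hi : p.1 = q.1
  · have hb : p.2 ≠ q.2 := fun hb => hpq (Prod.ext hi hb)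
    rw [if_pos hi, sgn_mul_of_ne hb]; linarith
  · rw [if_neg hi]
    rcases sgn_mul_sgn p.2 q.2 with hs | hs <;> rw [hs] <;>
      linarith [show (1 : ℝ) * (-1 / n) = -(1 / n) by ring, show (-1 : ℝ) * (-1 / n) = 1 / n by ring]

/-- **The `±` simplex as a code (every `n ≥ 2`)**: `2n + 2` unit vectors of `ℝⁿ` (a regular simplex and its antipodes)
with pairwise inner products `≤ 1/n`; so `A(n, arccos s) ≥ 2n + 2` whenever `s ≥ 1/n`.
[cite: ConwaySloane1999, Ch. 1 §2.3] -/
theorem exists_pm_simplex (n : ℕ) (hn : 2 ≤ n) : ∃ C : Finset (EuclideanSpace ℝ (Fin n)), C.card = 2 * n + 2 ∧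
    (∀ x ∈ C, ‖x‖ = 1) ∧ ∀ x ∈ C, ∀ y ∈ C, x ≠ y → inner ℝ x y ≤ 1 / (n : ℝ) := by
  classical
  have hn1 : 1 ≤ n := le_trans (by norm_num) hn
  obtain ⟨C', hcard, hnorm, hinner, -⟩ := exists_transfer_orthogonal_singleton (ones n) (ones_ne_zero n)
    ((univ : Finset (Fin (n + 1) × Bool)).image (pmVec n))
    (fun x hx => by obtain ⟨p, _, rfl⟩ := mem_image.mp hx; exact inner_ones_pmVec n p)
  refine ⟨C', ?_, ?_, ?_⟩
  · rw [hcard, card_image_of_injective _ (pmVec_injective hn), card_univ, Fintype.card_prod, Fintype.card_fin,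
      Fintype.card_bool]
    ring
  · intro x hx
    obtain ⟨y, hy, h⟩ := hnorm x hx
    obtain ⟨p, _, rfl⟩ := mem_image.mp hy
    rw [h, norm_pmVec hn1]
  · intro x hx y hy hxy
    obtain ⟨x0, hx0, y0, hy0, hne, he⟩ := hinner x hx y hy hxy
    obtain ⟨p, _, rfl⟩ := mem_image.mp hx0
    obtain ⟨q, _, rfl⟩ := mem_image.mp hy0
    rw [he]
    exact inner_pmVec_le hn1 fun h => hne (by rw [h])

/-! ## Two-sided ground-state energies in every dimension `n ≥ 3` -/

/-- **Ground-state energy of `2n` points on `Sⁿ⁻¹`, every `n ≥ 3`** (two-sided: the tree's universal optimality of the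
cross-polytope + the configuration `crossPolytope n`): for every potential `a(s) = Σ_k c_k (1+s)^k`, `c_k ≥ 0`, on `[-1, 1)`,
the least `a`-energy of `2n` unit vectors of `ℝⁿ` is `2n (a(-1) + (2n - 2) a(0))`. [cite: CohnKumar2006, Theorem 1.2] -/
theorem crossPolytope_energy_isLeast {n : ℕ} (hn : 3 ≤ n) (a : ℝ → ℝ) (c : ℕ → ℝ) (hc : ∀ k, 0 ≤ c k)
    (ha : ∀ s : ℝ, -1 ≤ s → s < 1 → HasSum (fun k => c k * (1 + s) ^ k) (a s)) :
    IsLeast {E : ℝ | ∃ C : Finset (EuclideanSpace ℝ (Fin n)), (∀ x ∈ C, ‖x‖ = 1) ∧ C.card = 2 * n ∧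
      E = ∑ x ∈ C, ∑ y ∈ C.erase x, a (inner ℝ x y)} ((2 * n : ℝ) * (a (-1) + (2 * n - 2) * a 0)) := by
  refine ⟨⟨crossPolytope n, norm_crossPolytope n, card_crossPolytope n, (crossPolytope_energy n a).symm⟩, ?_⟩
  rintro E ⟨C, h1, hN, rfl⟩
  exact Energy.UniversalCrossPolytope.universally_optimal hn a c hc ha C h1 hN

/-- **Ground-state energy of `n + 1` points on `Sⁿ⁻¹`, every `n ≥ 3`** (two-sided: the tree's universal optimality of the
simplex + the configuration of `exists_simplex`): for every potential `a(s) = Σ_k c_k (1+s)^k`, `c_k ≥ 0`, on `[-1, 1)`, the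
least `a`-energy of `n + 1` unit vectors of `ℝⁿ` is `(n + 1) n a(-1/n)`. [cite: CohnKumar2006, Theorem 1.2] -/
theorem simplex_energy_isLeast {n : ℕ} (hn : 3 ≤ n) (a : ℝ → ℝ) (c : ℕ → ℝ) (hc : ∀ k, 0 ≤ c k)
    (ha : ∀ s : ℝ, -1 ≤ s → s < 1 → HasSum (fun k => c k * (1 + s) ^ k) (a s)) :
    IsLeast {E : ℝ | ∃ C : Finset (EuclideanSpace ℝ (Fin n)), (∀ x ∈ C, ‖x‖ = 1) ∧ C.card = n + 1 ∧
      E = ∑ x ∈ C, ∑ y ∈ C.erase x, a (inner ℝ x y)} (((n : ℝ) + 1) * n * a (-1 / (n : ℝ))) := by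
  obtain ⟨S, hSc, hS1, -, he⟩ := exists_simplex n (le_trans (by norm_num) hn)
  refine ⟨⟨S, hS1, hSc, (he a).symm⟩, ?_⟩
  rintro E ⟨C, hC1, hN, rfl⟩
  have h := Energy.UniversalSimplex.universally_optimal hn (N := n + 1) (by omega) a c hc ha C hC1 hN
  have e1 : ((n + 1 : ℕ) : ℝ) - 1 = n := by push_cast; ring
  rw [e1] at h
  convert h using 1
  push_cast
  ring

end Summit.Ventures.PackingBounds.Config.SimplexCrossPolytope
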